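import Summits.CriticalPhenomena.PercolationContinuityZ3.Theorems.Transplant.FKConnectivityAllQEdgeToggle
import Summits.CriticalPhenomena.PercolationContinuityZ3.Theorems.PercNearOneGluingNoHeavyLowerTailCoSunflowerGlue
import HarnessLib

/-!
# Connectivity correlation inequalities for `φ_{w,q}`, every `q > 0` — the THREE-POINT FORM of adjacent-edge negative correlation

Support file (`--supports stmt-CriticalPhenomena-4575`), FK sub-lane `prim-bschramm-fk-3` (gen 6) of the post-continuity
programme; builds on p205010 (kernel theorem, internal audit signed; external expert review pending).  No definitions, no named
facts, no sorries; standard axioms.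

For two pairs `e = xy`, `f = xz` sharing the vertex `x`, the master identity `FK.negCorr_defect_eq` reduces
`φ_w(J_e ∩ J_f) ≤ φ_w(J_e)φ_w(J_f)` to the sign of a bracket of masses of the doubly pinned state `U = w[e↦0][f↦0]`.  Writing the five
partition-pattern masses of `{x, y, z}` under `U` — `A = S(x|y|z)`, `Bxy = S(xy|z)`, `Bxz = S(xz|y)`, `Byz = S(x|yz)`, `C = S(xyz)`, `Z` the
partition function — the bracket is `q·(S₀₀Z₀₁ − S₀₁Z₀₀) = Byz·(Z − (1−q)C) − (1−q)(A·C − Bxy·Bxz)` (toggle identity at `f` for the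
`f`-insensitive event "`y` is joined to neither `x` nor `z` off `f`").  Hence:
* **`FK.negCorr_adj_of_threePoint`** (`0 < q ≤ 1`): the THREE-POINT INEQUALITY `(1−q)(A·C − Bxy·Bxz) ≤ Byz·(Z − (1−q)C)` for `U`
  implies negative correlation of `J_{xy}` and `J_{xz}` under `φ_w`;
so the conjecture node `EdgeNegCorrAdjFKLtOne` (`…AllQAdjacent.lean`) follows from the three-point inequality for every finite weighted
graph (bschramm/FK-BARRIER.md §10.5; in probabilities: `(1−q)[P(x|y|z)P(xyz) − P(xy|z)P(xz|y)] ≤ P(x|yz)[1 − (1−q)P(xyz)]`, equivalently the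
hub covariance bound `Cov(1{x↔y},1{x↔z}) ≤ ν(x ↮ y ↔ z)/(1−q)`).
[cite: Grimmett2006, §3.9 eq. (3.94) (p. 63); Thm. (3.1)(a) (p. 37)] [cite: Wagner2006, Conj. 5.3 (p. 13)]
-/

noncomputable section

namespace Summit.CriticalPhenomena.PercolationContinuityZ3.Theorems

namespace FK

open MeasureTheory Set Literature.Probability.LatticeModels Literature.Probability.Percolation
open Literature.Probability.Percolation.DecisionTree (ind ind_of_mem ind_of_not_mem ind_nonneg)
open Literature.Probability.Percolation.TwoAvoidanceSets (ind_mul_ind)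
open scoped Classical symmDiff

variable {V : Type*} [Fintype V]

/-! ### Mass bookkeeping under almost-sure constraints -/

/-- If the pair `g` is almost surely open (`w g = 1`), two events that agree on `{g ∈ ω}` have the same mass. [folklore] -/
theorem sum_rcWeightW_ind_congr_of_one (w : Sym2 V → unitInterval) (q : ℝ) {g : Sym2 V} (h1 : (w g : ℝ) = 1)
    {E E' : Set (BondConfig V)} (hEE : ∀ ω : BondConfig V, g ∈ ω → (ω ∈ E ↔ ω ∈ E')) :
    ∑ ω : BondConfig V, rcWeightW w q ∅ ω * ind E ω = ∑ ω : BondConfig V, rcWeightW w q ∅ ω * ind E' ω := by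
  refine Finset.sum_congr rfl fun ω _ => ?_
  by_cases hg : g ∈ ω
  · by_cases hE : ω ∈ E
    · rw [ind_of_mem hE, ind_of_mem ((hEE ω hg).1 hE)]
    · rw [ind_of_not_mem hE, ind_of_not_mem (fun h => hE ((hEE ω hg).2 h))]
  · rw [rcWeightW_eq_zero_of_one_not_mem w q ∅ h1 hg, zero_mul, zero_mul]

/-- If the pair `g` is almost surely closed (`w g = 0`), two events that agree on `{g ∉ ω}` have the same mass. [folklore] -/
theorem sum_rcWeightW_ind_congr_of_zero (w : Sym2 V → unitInterval) (q : ℝ) {g : Sym2 V} (h0 : (w g : ℝ) = 0)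
    {E E' : Set (BondConfig V)} (hEE : ∀ ω : BondConfig V, g ∉ ω → (ω ∈ E ↔ ω ∈ E')) :
    ∑ ω : BondConfig V, rcWeightW w q ∅ ω * ind E ω = ∑ ω : BondConfig V, rcWeightW w q ∅ ω * ind E' ω := by
  refine Finset.sum_congr rfl fun ω _ => ?_
  by_cases hg : g ∈ ω
  · rw [rcWeightW_eq_zero_of_zero_mem w q ∅ h0 hg, zero_mul, zero_mul]
  · by_cases hE : ω ∈ E
    · rw [ind_of_mem hE, ind_of_mem ((hEE ω hg).1 hE)]
    · rw [ind_of_not_mem hE, ind_of_not_mem (fun h => hE ((hEE ω hg).2 h))]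

/-- Masses of equal events are equal. [folklore] -/
theorem sum_rcWeightW_ind_congr_set (w : Sym2 V → unitInterval) (q : ℝ) {E E' : Set (BondConfig V)} (h : E = E') :
    ∑ ω : BondConfig V, rcWeightW w q ∅ ω * ind E ω = ∑ ω : BondConfig V, rcWeightW w q ∅ ω * ind E' ω := by rw [h]

/-- Splitting a mass along an event: `S(F) = S(F ∩ A) + S(F ∩ Aᶜ)`. [folklore] -/
theorem sum_rcWeightW_ind_split (w : Sym2 V → unitInterval) (q : ℝ) (F A : Set (BondConfig V)) :
    ∑ ω : BondConfig V, rcWeightW w q ∅ ω * ind F ω =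
      ∑ ω : BondConfig V, rcWeightW w q ∅ ω * ind (F ∩ A) ω + ∑ ω : BondConfig V, rcWeightW w q ∅ ω * ind (F ∩ Aᶜ) ω := by
  rw [sum_rcWeightW_ind_inter_compl]; ring

/-! ### Connectivity off one pair -/

omit [Fintype V] in
/-- With the pair `xz` open, `x ↔ y` iff, OFF that pair, `y` is joined to `x` or to `z`. [folklore] -/
theorem reachable_iff_off_pair {x y z : V} {ω : BondConfig V} (hf : s(x, z) ∈ ω) :
    (openGraph ω).Reachable x y ↔
      (openGraph (ω \ {s(x, z)})).Reachable x y ∨ (openGraph (ω \ {s(x, z)})).Reachable z y := by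
  have hins : ω = insert s(x, z) (ω \ {s(x, z)}) := by
    ext g; simp only [Set.mem_insert_iff, Set.mem_sdiff, Set.mem_singleton_iff]
    constructor
    · intro hg; by_cases h : g = s(x, z); exacts [Or.inl h, Or.inr ⟨hg, h⟩]
    · rintro (rfl | ⟨hg, -⟩); exacts [hf, hg]
  conv_lhs => rw [hins]
  rw [CoSunflowerGlue.openGraph_insert, CoSunflowerGlue.reachable_sup_edge_iff']
  constructor
  · rintro (h | ⟨-, h⟩ | ⟨-, h⟩)
    · exact Or.inl h
    · exact Or.inr h
    · exact Or.inl h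
  · rintro (h | h)
    · exact Or.inl h
    · exact Or.inr (Or.inl ⟨SimpleGraph.Reachable.refl _, h⟩)

/-! ### The three-point form -/

/-- **Adjacent-edge negative correlation from the THREE-POINT INEQUALITY.**  Let `e = xy`, `f = xz` (`y ≠ z`), `0 < q ≤ 1`, and
`U = w[e ↦ 0][f ↦ 0]`.  With the pattern masses of `{x, y, z}` under `U` — `A = S_U(x ↮ y, x ↮ z, y ↮ z)`, `Bxy = S_U(x ↔ y, x ↮ z)`,
`Bxz = S_U(x ↮ y, x ↔ z)`, `Byz = S_U(x ↮ y, y ↔ z)`, `C = S_U(x ↔ y, x ↔ z)`, `Z = Z_U` — if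
`(1 − q)·(A·C − Bxy·Bxz) ≤ Byz·(Z − (1 − q)·C)` then `φ_w(J_e ∩ J_f) ≤ φ_w(J_e)·φ_w(J_f)`.
[cite: Grimmett2006, §3.9 eq. (3.94) (p. 63); Thm. (3.1)(a) (p. 37)] [cite: Wagner2006, Conj. 5.3 (p. 13)] -/
theorem negCorr_adj_of_threePoint {q : ℝ} (hq0 : 0 < q) (hq1 : q ≤ 1) (w : Sym2 V → unitInterval) (x y z : V) (hyz : y ≠ z)
    (h3 : (1 - q) *
        ((∑ ω : BondConfig V, rcWeightW (Function.update (Function.update w s(x, y) 0) s(x, z) 0) q ∅ ω *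
            ind ((openConn x y : Set (BondConfig V))ᶜ ∩ (openConn x z : Set (BondConfig V))ᶜ ∩ (openConn y z : Set (BondConfig V))ᶜ) ω) *
          (∑ ω : BondConfig V, rcWeightW (Function.update (Function.update w s(x, y) 0) s(x, z) 0) q ∅ ω *
            ind (openConn x y ∩ openConn x z) ω) -
         (∑ ω : BondConfig V, rcWeightW (Function.update (Function.update w s(x, y) 0) s(x, z) 0) q ∅ ω *
            ind (openConn x y ∩ (openConn x z : Set (BondConfig V))ᶜ) ω) *
          (∑ ω : BondConfig V, rcWeightW (Function.update (Function.update w s(x, y) 0) s(x, z) 0) q ∅ ω *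
            ind ((openConn x y : Set (BondConfig V))ᶜ ∩ openConn x z) ω)) ≤
        (∑ ω : BondConfig V, rcWeightW (Function.update (Function.update w s(x, y) 0) s(x, z) 0) q ∅ ω *
            ind ((openConn x y : Set (BondConfig V))ᶜ ∩ openConn y z) ω) *
          (rcPartitionFunctionW (Function.update (Function.update w s(x, y) 0) s(x, z) 0) q ∅ -
            (1 - q) * ∑ ω : BondConfig V, rcWeightW (Function.update (Function.update w s(x, y) 0) s(x, z) 0) q ∅ ω *
              ind (openConn x y ∩ openConn x z) ω)) :
    (rcMeasureW w q ∅).real ({ω | s(x, y) ∈ ω} ∩ {ω | s(x, z) ∈ ω}) ≤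
      (rcMeasureW w q ∅).real {ω | s(x, y) ∈ ω} * (rcMeasureW w q ∅).real {ω | s(x, z) ∈ ω} := by
  have hfe : s(x, z) ≠ s(x, y) := by
    intro h
    rw [Sym2.eq_iff] at h
    rcases h with ⟨-, h⟩ | ⟨h1, h2⟩
    · exact hyz h.symm
    · exact hyz (h2.trans h1).symm
  -- names
  set U : Sym2 V → unitInterval := Function.update (Function.update w s(x, y) 0) s(x, z) 0 with hU
  set U1 : Sym2 V → unitInterval := Function.update (Function.update w s(x, y) 0) s(x, z) 1 with hU1
  set Exy : Set (BondConfig V) := openConn x y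
  set Exz : Set (BondConfig V) := openConn x z
  set Eyz : Set (BondConfig V) := openConn y z
  set A := ∑ ω : BondConfig V, rcWeightW U q ∅ ω * ind (Exyᶜ ∩ Exzᶜ ∩ Eyzᶜ) ω with hA
  set Bxy := ∑ ω : BondConfig V, rcWeightW U q ∅ ω * ind (Exy ∩ Exzᶜ) ω with hBxy
  set Bxz := ∑ ω : BondConfig V, rcWeightW U q ∅ ω * ind (Exyᶜ ∩ Exz) ω with hBxz
  set Byz := ∑ ω : BondConfig V, rcWeightW U q ∅ ω * ind (Exyᶜ ∩ Eyz) ω with hByz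
  set C := ∑ ω : BondConfig V, rcWeightW U q ∅ ω * ind (Exy ∩ Exz) ω with hC
  set Z := rcPartitionFunctionW U q ∅ with hZ
  -- the `f`-insensitive event: `y` joined to neither `x` nor `z` off `f`
  set F : Set (BondConfig V) := {ω | ¬ (openGraph (ω \ {s(x, z)})).Reachable x y ∧ ¬ (openGraph (ω \ {s(x, z)})).Reachable z y}
    with hF
  have hFins : ∀ ω : BondConfig V, ω ∆ {s(x, z)} ∈ F ↔ ω ∈ F := by
    intro ω
    have : (ω ∆ {s(x, z)}) \ {s(x, z)} = ω \ {s(x, z)} := by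
      ext g
      simp only [Set.mem_sdiff, Set.mem_symmDiff, Set.mem_singleton_iff]
      tauto
    simp only [hF, Set.mem_setOf_eq, this]
  -- toggle identities at `f`
  have hZ1 : rcPartitionFunctionW U1 q ∅ = Z + (q⁻¹ - 1) * ∑ ω : BondConfig V, rcWeightW U q ∅ ω * ind Exzᶜ ω :=
    rcPartitionFunctionW_update_one_eq_toggle (Function.update w s(x, y) 0) hq0.ne' x z
  have hS1F : ∑ ω : BondConfig V, rcWeightW U1 q ∅ ω * ind F ω =
      ∑ ω : BondConfig V, rcWeightW U q ∅ ω * ind F ω +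
        (q⁻¹ - 1) * ∑ ω : BondConfig V, rcWeightW U q ∅ ω * ind (F ∩ Exzᶜ) ω :=
    sum_rcWeightW_update_one_eq_toggle (Function.update w s(x, y) 0) hq0.ne' x z F hFins
  -- under `U1` (`f` open a.s.), `{x ↮ y}` is `F`
  have hS1 : ∑ ω : BondConfig V, rcWeightW U1 q ∅ ω * ind Exyᶜ ω = ∑ ω : BondConfig V, rcWeightW U1 q ∅ ω * ind F ω := by
    refine sum_rcWeightW_ind_congr_of_one U1 q (g := s(x, z)) (by simp [hU1]) fun ω hω => ?_
    rw [Set.mem_compl_iff, mem_openConn_iff', reachable_iff_off_pair hω, hF, Set.mem_setOf_eq, not_or]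
  -- under `U` (`f` closed a.s.), `F` is `{x ↮ y} ∩ {z ↮ y}`
  have hdel : ∀ ω : BondConfig V, s(x, z) ∉ ω → ω \ {s(x, z)} = ω := fun ω hω =>
    Set.sdiff_singleton_eq_self hω
  have hS0F : ∑ ω : BondConfig V, rcWeightW U q ∅ ω * ind F ω = Bxz + A := by
    have h1 : ∑ ω : BondConfig V, rcWeightW U q ∅ ω * ind F ω =
        ∑ ω : BondConfig V, rcWeightW U q ∅ ω * ind (Exyᶜ ∩ Eyzᶜ) ω := by
      refine sum_rcWeightW_ind_congr_of_zero U q (g := s(x, z)) (by simp [hU]) fun ω hω => ?_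
      rw [hF, Set.mem_setOf_eq, hdel ω hω, Set.mem_inter_iff, Set.mem_compl_iff, Set.mem_compl_iff, mem_openConn_iff',
        mem_openConn_iff']
      exact ⟨fun ⟨h1, h2⟩ => ⟨h1, fun h => h2 h.symm⟩, fun ⟨h1, h2⟩ => ⟨h1, fun h => h2 h.symm⟩⟩
    rw [h1, sum_rcWeightW_ind_split U q (Exyᶜ ∩ Eyzᶜ) Exz, hBxz, hA]
    congr 1
    · refine sum_rcWeightW_ind_congr_set U q (Set.ext fun ω => ?_)
      simp only [Set.mem_inter_iff, Set.mem_compl_iff]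
      constructor
      · rintro ⟨⟨h1, -⟩, h3⟩
        exact ⟨h1, h3⟩
      · rintro ⟨h1, h3⟩
        refine ⟨⟨h1, fun h => h1 ?_⟩, h3⟩
        exact SimpleGraph.Reachable.trans (h3 : (openGraph ω).Reachable x z)
          (SimpleGraph.Reachable.symm (h : (openGraph ω).Reachable y z))
    · exact sum_rcWeightW_ind_congr_set U q (Set.inter_right_comm _ _ _)
  -- `S_U(F ∩ {x ↮ z}) = A`
  have hS0Fxz : ∑ ω : BondConfig V, rcWeightW U q ∅ ω * ind (F ∩ Exzᶜ) ω = A := by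
    rw [hA]
    refine sum_rcWeightW_ind_congr_of_zero U q (g := s(x, z)) (by simp [hU]) fun ω hω => ?_
    rw [Set.mem_inter_iff, hF, Set.mem_setOf_eq, hdel ω hω, Set.mem_inter_iff, Set.mem_inter_iff, Set.mem_compl_iff,
      Set.mem_compl_iff, Set.mem_compl_iff, mem_openConn_iff', mem_openConn_iff', mem_openConn_iff']
    constructor
    · rintro ⟨⟨h1, h2⟩, h3⟩; exact ⟨⟨h1, h3⟩, fun h => h2 h.symm⟩
    · rintro ⟨⟨h1, h3⟩, h2⟩; exact ⟨⟨h1, fun h => h2 h.symm⟩, h3⟩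
  -- `S_U(x ↮ y) = Bxz + (Byz + A)` and `S_U(x ↮ z) = Bxy + (Byz + A)`
  have hByzA : ∑ ω : BondConfig V, rcWeightW U q ∅ ω * ind (Exyᶜ ∩ Exzᶜ) ω = Byz + A := by
    rw [sum_rcWeightW_ind_split U q (Exyᶜ ∩ Exzᶜ) Eyz, hByz, hA]
    congr 1
    refine sum_rcWeightW_ind_congr_set U q (Set.ext fun ω => ?_)
    simp only [Set.mem_inter_iff, Set.mem_compl_iff]
    constructor
    · rintro ⟨⟨h1, -⟩, h3⟩; exact ⟨h1, h3⟩
    · rintro ⟨h1, h3⟩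
      refine ⟨⟨h1, fun h => h1 ?_⟩, h3⟩
      exact SimpleGraph.Reachable.trans (h : (openGraph ω).Reachable x z)
        (SimpleGraph.Reachable.symm (h3 : (openGraph ω).Reachable y z))
  have hS00 : ∑ ω : BondConfig V, rcWeightW U q ∅ ω * ind Exyᶜ ω = Bxz + (Byz + A) := by
    rw [sum_rcWeightW_ind_split U q Exyᶜ Exz, hBxz, hByzA]
  have hSxz : ∑ ω : BondConfig V, rcWeightW U q ∅ ω * ind Exzᶜ ω = Bxy + (Byz + A) := by
    rw [sum_rcWeightW_ind_split U q Exzᶜ Exy, hBxy, ← hByzA, Set.inter_comm Exzᶜ Exy]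
    congr 1
    exact sum_rcWeightW_ind_congr_set U q (Set.inter_comm _ _)
  -- `Z = C + Bxy + (Bxz + (Byz + A))`
  have hZsum : Z = C + Bxy + (Bxz + (Byz + A)) := by
    have h1 := sum_rcWeightW_ind_compl U q Exy
    rw [hS00] at h1
    have h2 : ∑ ω : BondConfig V, rcWeightW U q ∅ ω * ind Exy ω = C + Bxy := by
      rw [sum_rcWeightW_ind_split U q Exy Exz, hC, hBxy]
    rw [hZ]; linarith
  -- the pinned masses in terms of the pattern masses
  have hS01 : ∑ ω : BondConfig V, rcWeightW U1 q ∅ ω * ind Exyᶜ ω = (Bxz + A) + (q⁻¹ - 1) * A := by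
    rw [hS1, hS1F, hS0F, hS0Fxz]
  have hZ01 : rcPartitionFunctionW U1 q ∅ = Z + (q⁻¹ - 1) * (Bxy + (Byz + A)) := by rw [hZ1, hSxz]
  -- the master identity
  have hm := negCorr_defect_eq w hq0.ne' x y hfe
  rw [← hU, ← hU1] at hm
  -- clean up: events of `hm` in our names
  change (∑ ω : BondConfig V, rcWeightW w q ∅ ω * ind ({ω | s(x, y) ∈ ω} ∩ {ω | s(x, z) ∈ ω}) ω) * rcPartitionFunctionW w q ∅ -
      (∑ ω : BondConfig V, rcWeightW w q ∅ ω * ind {ω | s(x, y) ∈ ω} ω) *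
        (∑ ω : BondConfig V, rcWeightW w q ∅ ω * ind {ω | s(x, z) ∈ ω} ω) =
      (w s(x, y) : ℝ) * (1 - (w s(x, y) : ℝ)) * ((w s(x, z) : ℝ) * (1 - (w s(x, z) : ℝ))) * (q⁻¹ - 1) *
        ((∑ ω : BondConfig V, rcWeightW U1 q ∅ ω * ind Exyᶜ ω) * Z -
          (∑ ω : BondConfig V, rcWeightW U q ∅ ω * ind Exyᶜ ω) * rcPartitionFunctionW U1 q ∅) at hm
  rw [hS01, hZ01, hS00] at hm
  -- nonnegativity bookkeeping
  have hZpos := rcPartitionFunctionW_pos w hq0 (∅ : Set V)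
  have hc0 : 0 ≤ (w s(x, y) : ℝ) := (w _).2.1
  have hc1 : (w s(x, y) : ℝ) ≤ 1 := (w _).2.2
  have hd0 : 0 ≤ (w s(x, z) : ℝ) := (w _).2.1
  have hd1 : (w s(x, z) : ℝ) ≤ 1 := (w _).2.2
  have hq' : 0 ≤ q⁻¹ - 1 := by rw [sub_nonneg]; exact one_le_inv_iff₀.2 ⟨hq0, hq1⟩
  have hpre : 0 ≤ (w s(x, y) : ℝ) * (1 - (w s(x, y) : ℝ)) * ((w s(x, z) : ℝ) * (1 - (w s(x, z) : ℝ))) * (q⁻¹ - 1) :=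
    mul_nonneg (mul_nonneg (mul_nonneg hc0 (by linarith)) (mul_nonneg hd0 (by linarith))) hq'
  -- the bracket is `≤ 0` by the three-point inequality: q·bracket = −[Byz(Z − (1−q)C) − (1−q)(AC − Bxy·Bxz)]
  have hbr : ((Bxz + A) + (q⁻¹ - 1) * A) * Z - (Bxz + (Byz + A)) * (Z + (q⁻¹ - 1) * (Bxy + (Byz + A))) ≤ 0 := by
    have hqinv : q⁻¹ = 1 / q := inv_eq_one_div q
    have key : q * (((Bxz + A) + (q⁻¹ - 1) * A) * Z - (Bxz + (Byz + A)) * (Z + (q⁻¹ - 1) * (Bxy + (Byz + A)))) =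
        -(Byz * (Z - (1 - q) * C) - (1 - q) * (A * C - Bxy * Bxz)) := by
      rw [hZsum]; field_simp; ring
    have hneg : q * (((Bxz + A) + (q⁻¹ - 1) * A) * Z - (Bxz + (Byz + A)) * (Z + (q⁻¹ - 1) * (Bxy + (Byz + A)))) ≤ 0 := by
      rw [key]; linarith
    by_contra hpos
    push Not at hpos
    have := mul_pos hq0 hpos
    linarith
  have h1 := mul_nonpos_iff.2 (Or.inl ⟨hpre, hbr⟩)
  have h2 : (∑ ω : BondConfig V, rcWeightW w q ∅ ω * ind ({ω | s(x, y) ∈ ω} ∩ {ω | s(x, z) ∈ ω}) ω) *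
      rcPartitionFunctionW w q ∅ ≤
      (∑ ω : BondConfig V, rcWeightW w q ∅ ω * ind {ω | s(x, y) ∈ ω} ω) *
        (∑ ω : BondConfig V, rcWeightW w q ∅ ω * ind {ω | s(x, z) ∈ ω} ω) := by linarith [hm, h1]
  rw [rcMeasureW_real_eq_sum_div w hq0 ∅, rcMeasureW_real_eq_sum_div w hq0 ∅, rcMeasureW_real_eq_sum_div w hq0 ∅,
    div_mul_div_comm, div_le_div_iff₀ hZpos (mul_pos hZpos hZpos)]
  calc (∑ ω : BondConfig V, rcWeightW w q ∅ ω * ind ({ω | s(x, y) ∈ ω} ∩ {ω | s(x, z) ∈ ω}) ω) *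
        (rcPartitionFunctionW w q ∅ * rcPartitionFunctionW w q ∅)
      = (∑ ω : BondConfig V, rcWeightW w q ∅ ω * ind ({ω | s(x, y) ∈ ω} ∩ {ω | s(x, z) ∈ ω}) ω) *
        rcPartitionFunctionW w q ∅ * rcPartitionFunctionW w q ∅ := by ring
    _ ≤ (∑ ω : BondConfig V, rcWeightW w q ∅ ω * ind {ω | s(x, y) ∈ ω} ω) *
        (∑ ω : BondConfig V, rcWeightW w q ∅ ω * ind {ω | s(x, z) ∈ ω} ω) * rcPartitionFunctionW w q ∅ :=
        mul_le_mul_of_nonneg_right h2 hZpos.le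

end FK

end Summit.CriticalPhenomena.PercolationContinuityZ3.Theorems

end
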